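import Mathlib
import Summits.CriticalPhenomena.CardyFormulaZ2.Theorems.CardyFlipRussoSquareFromVoronoiHubDefs
import Summits.CriticalPhenomena.CardyFormulaZ2.Theorems.CardyFlipRussoSquareFromVoronoiHubFaithfulPart1
import Literature.Probability.Percolation.TriVoronoiCells
import Literature.Probability.Percolation.SitePaths
import Literature.Probability.Percolation.VoronoiCrossing

/-!
# Stub `stub_faithful` (K1), line `Sketch` of crux `SquareFromVoronoiHub` — Part 2:
# the lattice shadow of a continuum on `G_s`

Crux `Summit.CriticalPhenomena.CardyFormulaZ2.Theses.CardyFlipRusso.SquareFromVoronoiHub`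
(stmt-CriticalPhenomena-6434), line `Sketch` (card `voronoi-blocks-on-fixed-gs`), stub
`stub_faithful` ("faithful discretisation at cell scale `δ^{1/4}`": the crude `G_s(δ)` crossing
probability of the Voronoi block colouring and the continuum Poisson–Voronoi crossing probability
at mesh `δ^{1/4}` differ by `o(1)`); registered sub-goal `stub_faithful_part2a`.  This file is the
DETERMINISTIC LATTICE half of step (1)(b) of that stub, over Part 1 (geometry of `G_s`):

* **the lattice path of a continuum** (`exists_pathIn_Gs`; Bollobás–Riordan, *Percolation*
  (2006), Ch. 7, proof of Thm. 2, p. 199, "a connected black set contains a lattice path", here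
  for `G_s`): a bounded preconnected `S ⊆ ℂ` and `p, q ∈ S` yield sites `u`, `w` of `δ • G_s`
  within `δ/2` of `p`, `q` joined by a `G_s`-path of sites within `δ/2` of `S` (closed
  `δ/2`-balls about the sites cover the plane; a finite closed cover of a preconnected set is
  chain-connected, `reflTransGen_of_isPreconnected_of_finite_cover` of the tree; consecutive
  sites are equal, adjacent or linked through a corner, Part 1's core lemma);
* its reading for the crux's crude event (`mem_crudeCrossing_of_isPreconnected`,
  `mem_crudeCrossing_of_joinedIn`): a continuum from
  within `3δ/2` of `(ab)` to within `3δ/2` of `(cd)` all of whose `δ/2`-neighbouring sites are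
  open and inside `Ω` puts the configuration in `crudeCrossing R δ`;
* (Part 6, over Parts 4, 5, 7) the boundary layer: ROBUSTLY black paths — all sites within `δ/2`
  of them black — from within `δ` of `(ab)` (or from deep in an exterior cap beyond `(ab)`) to
  within `δ` of `(cd)` give the crude block crossing with the crux's `2δ` slack, for EVERY
  conformal rectangle.

What remains for the stub (probabilistic; Part 3 is the squeeze from the sandwich): robustly black
paths from continuum crossings of perturbed rectangles outside an event of probability `o(1)` (no
sub-mesh Voronoi defects: the path through in-discs and shared-edge midpoints of the black cells of
a crossing of a rectangle with exterior caps beyond `(ab)`, `(cd)` is robustly black and satisfies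
`hcl`), the dual (white) direction, and the perturbed rectangles with cross-ratio continuity.
-/

noncomputable section

namespace Summit.CriticalPhenomena.CardyFormulaZ2.Cruxes.SquareFromVoronoiHub.VoronoiBlocks.Faithful

open scoped Pointwise Topology
open Set Metric Filter
open Literature.Probability.Percolation (SiteConfig siteConnIn PathIn blackRegion
  mem_siteConnIn_iff_pathIn reflTransGen_of_isPreconnected_of_finite_cover)
open Literature.Probability.RandomPlanarGeometry (ConformalRectangle)
open Literature.Analysis.FunctionSpaces (PointConfig)

/-! ### The lattice path of a continuum -/

/-- **The lattice path of a continuum on `δ • G_s`.**  Let `S ⊆ ℂ` be bounded and preconnected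
and `p, q ∈ S`.  Then there are sites `u`, `w` within `δ/2` of `p`, `q` joined by a `G_s`-path
all of whose sites are within `δ/2` of some point of `S` (the closed `δ/2`-balls about the sites
cover `S`; a finite closed cover of a preconnected set is chain-connected through points of the
set; consecutive sites of the chain are equal, adjacent, or linked through a corner within `δ/2`
of their common point).  The `G_s` twin of the tree's `exists_pathIn_of_subset_triVoronoiCell`.
[cite: BollobasRiordan2006, Ch. 7 proof of Thm. 2 p. 199] -/
theorem exists_pathIn_Gs {δ : ℝ} (hδ : 0 < δ) {S : Set ℂ} (hS : IsPreconnected S)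
    (hSb : Bornology.IsBounded S) {p q : ℂ} (hp : p ∈ S) (hq : q ∈ S) :
    ∃ u w : (ℤ × ℤ) ⊕ (ℤ × ℤ), dist p ((δ : ℂ) * zGs u) ≤ δ / 2 ∧ dist q ((δ : ℂ) * zGs w) ≤ δ / 2 ∧
      PathIn Gs {v | ∃ s ∈ S, dist s ((δ : ℂ) * zGs v) ≤ δ / 2} u w := by
  set F : Set ((ℤ × ℤ) ⊕ (ℤ × ℤ)) := {v | ∃ s ∈ S, dist s ((δ : ℂ) * zGs v) ≤ δ / 2} with hF
  -- `F` is finite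
  obtain ⟨M, hM⟩ := hSb.subset_closedBall 0
  have hFfin : F.Finite := by
    refine (finite_setOf_dist_mul_zGs_le hδ 0 (M + δ / 2)).subset ?_
    rintro v ⟨s, hs, hsv⟩
    have hs0 : dist s 0 ≤ M := mem_closedBall.1 (hM hs)
    calc dist 0 ((δ : ℂ) * zGs v) ≤ dist 0 s + dist s ((δ : ℂ) * zGs v) := dist_triangle _ _ _
      _ ≤ M + δ / 2 := add_le_add (by rwa [dist_comm]) hsv
  -- the closed `δ/2`-balls about the sites of `F` cover `S`
  have hcov : S ⊆ ⋃ v ∈ F, closedBall ((δ : ℂ) * zGs v) (δ / 2) := by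
    intro s hs
    obtain ⟨v, hv⟩ := exists_dist_mul_zGs_le hδ s
    exact mem_iUnion₂.2 ⟨v, ⟨s, hs, hv⟩, mem_closedBall.2 hv⟩
  obtain ⟨u, hu⟩ := exists_dist_mul_zGs_le hδ p
  obtain ⟨w, hw⟩ := exists_dist_mul_zGs_le hδ q
  have huF : u ∈ F := ⟨p, hp, hu⟩
  have hwF : w ∈ F := ⟨q, hq, hw⟩
  have hchain := reflTransGen_of_isPreconnected_of_finite_cover hS hFfin
    (fun v _ => isClosed_closedBall) hcov huF ⟨p, hp, mem_closedBall.2 hu⟩ hwF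
    ⟨q, hq, mem_closedBall.2 hw⟩
  refine ⟨u, w, hu, hw, ?_⟩
  clear hu hw hwF
  induction hchain with
  | refl => exact PathIn.refl huF
  | tail _ hst ih =>
    obtain ⟨_, htF, x, ⟨hxS, hxs⟩, hxt⟩ := hst
    rw [mem_closedBall] at hxs hxt
    rcases eq_or_adj_or_exists_of_dist_mul_le hδ hxs hxt with h | h | ⟨c, h1, h2, h3⟩
    · rw [← h]; exact ih
    · exact ih.tail h htF
    · exact (ih.tail h1 ⟨x, hxS, h3⟩).tail h2 htF

/-! ### Reading for the crude crossing event of the crux -/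

/-- **A continuum near which all sites are open and inside `Ω` gives a crude crossing.**  If a
bounded preconnected `S` contains a point within `3δ/2` of the arc `(ab) = R.arc 0` and a point
within `3δ/2` of `(cd) = R.arc 2`, and every site of `δ • G_s` within `δ/2` of `S` is open in
`ω` and lies in `Ω`, then `ω ∈ crudeCrossing R δ` (the endpoints of the lattice path are within
`3δ/2 + δ/2 = 2δ` of the arcs). [folklore] -/
theorem mem_crudeCrossing_of_isPreconnected (R : ConformalRectangle) {δ : ℝ} (hδ : 0 < δ)
    {ω : SiteConfig ((ℤ × ℤ) ⊕ (ℤ × ℤ))} {S : Set ℂ} (hS : IsPreconnected S)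
    (hSb : Bornology.IsBounded S) {p q : ℂ} (hp : p ∈ S) (hq : q ∈ S)
    (hp0 : infDist p (R.arc 0) ≤ 3 / 2 * δ) (hq2 : infDist q (R.arc 2) ≤ 3 / 2 * δ)
    (hgood : ∀ v, (∃ s ∈ S, dist s ((δ : ℂ) * zGs v) ≤ δ / 2) → v ∈ ω ∧ (δ : ℂ) * zGs v ∈ R.carrier) :
    ω ∈ crudeCrossing R δ := by
  obtain ⟨u, w, hu, hw, hpath⟩ := exists_pathIn_Gs hδ hS hSb hp hq
  refine ⟨u, w, ?_, ?_, ?_⟩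
  · calc infDist ((δ : ℂ) * zGs u) (R.arc 0) ≤ infDist p (R.arc 0) + dist ((δ : ℂ) * zGs u) p :=
          infDist_le_infDist_add_dist
      _ ≤ 3 / 2 * δ + δ / 2 := add_le_add hp0 (by rwa [dist_comm])
      _ = 2 * δ := by ring
  · calc infDist ((δ : ℂ) * zGs w) (R.arc 2) ≤ infDist q (R.arc 2) + dist ((δ : ℂ) * zGs w) q :=
          infDist_le_infDist_add_dist
      _ ≤ 3 / 2 * δ + δ / 2 := add_le_add hq2 (by rwa [dist_comm])
      _ = 2 * δ := by ring
  · exact mem_siteConnIn_iff_pathIn.2 (hpath.mono fun v hv => ⟨(hgood v hv).2, (hgood v hv).1⟩)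

/-- **A continuum path near which all sites are open and inside `Ω` gives a crude crossing**:
the `JoinedIn` form (the range of a path is compact and connected). [folklore] -/
theorem mem_crudeCrossing_of_joinedIn (R : ConformalRectangle) {δ : ℝ} (hδ : 0 < δ)
    {ω : SiteConfig ((ℤ × ℤ) ⊕ (ℤ × ℤ))} {K : Set ℂ} {p q : ℂ} (h : JoinedIn K p q)
    (hp0 : infDist p (R.arc 0) ≤ 3 / 2 * δ) (hq2 : infDist q (R.arc 2) ≤ 3 / 2 * δ)
    (hgood : ∀ v, (∃ s ∈ K, dist s ((δ : ℂ) * zGs v) ≤ δ / 2) → v ∈ ω ∧ (δ : ℂ) * zGs v ∈ R.carrier) :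
    ω ∈ crudeCrossing R δ := by
  set γ := h.somePath with hγ
  have hSK : range γ ⊆ K := by
    rintro _ ⟨t, rfl⟩
    exact h.somePath_mem t
  refine mem_crudeCrossing_of_isPreconnected R hδ (isConnected_range γ.continuous).isPreconnected
    (isCompact_range γ.continuous).isBounded ⟨0, γ.source⟩ ⟨1, γ.target⟩ hp0 hq2 ?_
  rintro v ⟨s, hs, hsv⟩
  exact hgood v ⟨s, hSK hs, hsv⟩

/-- **Registered sub-goal `stub_faithful_part2a`** of `stub_faithful` (K1): the lattice shadow
of a continuum read for the crux's crude event — a bounded preconnected set from within `3δ/2` of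
`(ab)` to within `3δ/2` of `(cd)`, all of whose `δ/2`-neighbouring sites of `δ • G_s` are open and
inside `Ω`, puts the configuration in `crudeCrossing R δ` (statement of
`mem_crudeCrossing_of_isPreconnected`). [folklore] -/
theorem stub_faithful_part2a : ∀ (R : ConformalRectangle) {δ : ℝ}, 0 < δ → ∀ {ω : SiteConfig ((ℤ × ℤ) ⊕ (ℤ × ℤ))} {S : Set ℂ}, IsPreconnected S → Bornology.IsBounded S → ∀ {p q : ℂ}, p ∈ S → q ∈ S → Metric.infDist p (R.arc 0) ≤ 3 / 2 * δ → Metric.infDist q (R.arc 2) ≤ 3 / 2 * δ → (∀ v, (∃ s ∈ S, dist s ((δ : ℂ) * zGs v) ≤ δ / 2) → v ∈ ω ∧ (δ : ℂ) * zGs v ∈ R.carrier) → ω ∈ crudeCrossing R δ :=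
  fun R _ hδ _ _ hS hSb _ _ hp hq hp0 hq2 hgood =>
    mem_crudeCrossing_of_isPreconnected R hδ hS hSb hp hq hp0 hq2 hgood

end Summit.CriticalPhenomena.CardyFormulaZ2.Cruxes.SquareFromVoronoiHub.VoronoiBlocks.Faithful

end
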